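import Mathlib.Data.List.GetD
import Mathlib.Data.Fin.VecNotation
import Literature.Computability.FineGrained.SetCoverConjecture
import HarnessLib

/-!
# Pratt's reduction from `s`-Set Cover to Balanced Tripartitioning: glue to the problem statements

Topic `Computability/FineGrained`. Companion of `PrattSetCoverReduction.lean` (the machine-free
combinatorics of the reduction in the proof of K. Pratt, STOC 2024, arXiv:2311.02774, Cor. 1.10),
connecting its finite-set-family statements to the tree's word-RAM problems of
`Literature.Computability.FineGrained.SetCoverConjecture`:

* `SetCoverInstance.family` — the listed subsets of a set-cover instance
  (`Literature.Computability.Complexity.SetCoverInstance`: ground set `[n]`, subsets as lists of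
  naturals, budget `K`) as a `Finset (Finset ℕ)`; for a well-formed `s`-instance
  (`SetCoverInstance.IsSetFamily s`, the instance set of `FineGrained.SetCover s`) it is a family
  of `≤ s`-subsets of `Finset.range n` (`family_subset_powerset_range`, `card_le_of_mem_family`),
  and **`SetCoverInstance.hasCoverWithin_iff_family`**: the acceptance predicate
  `HasCoverWithin` of `SetCover s` (some `≤ K` listed sets cover `[n]`, by indices) is
  `∃ G ⊆ family, |G| ≤ K ∧ range n ⊆ ⋃ G` — the left-hand side of
  `exists_cover_iff_exists_boundary_tripartition` of the companion file.
* **`TripartitioningInstance.hasTripartition_iff_of_map`** — the acceptance predicate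
  `HasTripartition` of `BalancedTripartitioning` (some `S ∈ 𝓕₀, T ∈ 𝓕₁, U ∈ 𝓕₂` with
  `S ∪ T ∪ U = [3n]`) for an instance whose families are, along an injective relabelling
  `e : Fin (3n) ↪ β`, three given families of subsets of the range of `e`, is
  "some `Y_i ∈ Fam_i` are pairwise disjoint with union the range" — the right-hand side of the
  companion's equivalence (there `β = ℕ`, range `= [n] ∖ S`); the passage from
  "`S ∪ T ∪ U = [3n]`" to pairwise disjointness is the count
  `disjoint_of_card_of_union_eq_univ` (three `n`-sets filling a `3n`-set).

The four `SetCoverInstance.…` declarations are dot-notation extensions of the structure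
`Literature.Computability.Complexity.SetCoverInstance` (directory `Complexity/`), declared with
their absolute names (CONVENTIONS §2), as in `SetCoverConjecture.lean`.

## What is NOT here

The word-RAM programmes (parsing `SetCoverInstance.wordEncode`, writing
`TripartitioningInstance.wordEncode`, the dynamic programme, subroutine calls) and every
running-time statement; see the module docstring of `PrattSetCoverReduction.lean`.

## References

* [Pratt2024SCC] K. Pratt, *A stronger connection between the asymptotic rank conjecture and the
  set cover conjecture*, Proc. 56th STOC (2024), doi:10.1145/3618260.3649620, arXiv:2311.02774 —
  Problem 1.1, Problem 1.3, proof of Cor. 1.10.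
-/

namespace Literature.Computability.FineGrained

open Complexity

/-! ## `s`-Set Cover instances as finite set families -/

/-- The set family `𝓕 ⊆ 2^{[n]}` of a set-cover instance: the listed subsets as finite sets.
(Dot-notation extension of `Literature.Computability.Complexity.SetCoverInstance`.)
[cite: Pratt2024SCC, Problem 1.1] -/
def _root_.Literature.Computability.Complexity.SetCoverInstance.family (I : SetCoverInstance) :
    Finset (Finset ℕ) :=
  (I.sets.map List.toFinset).toFinset

/-- Membership in the set family of an instance. (Dot-notation extension.) [folklore] -/
theorem _root_.Literature.Computability.Complexity.SetCoverInstance.mem_family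
    {I : SetCoverInstance} {Y : Finset ℕ} : Y ∈ I.family ↔ ∃ S ∈ I.sets, S.toFinset = Y := by
  simp [SetCoverInstance.family]

/-- The `j`-th listed subset, as a finite set, belongs to the family. (Dot-notation extension.)
[folklore] -/
theorem _root_.Literature.Computability.Complexity.SetCoverInstance.toFinset_subsetAt_mem_family
    {I : SetCoverInstance} {j : ℕ} (hj : j < I.sets.length) :
    (I.subsetAt j).toFinset ∈ I.family := by
  rw [SetCoverInstance.mem_family]
  refine ⟨I.subsetAt j, ?_, rfl⟩
  unfold SetCoverInstance.subsetAt
  rw [List.getD_eq_getElem _ _ hj]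
  exact List.getElem_mem hj

/-- The family of a well-formed instance consists of subsets of the ground set `[n]`
(Problem 1.1: "`𝓕 ⊆ 2^{[n]}`"). (Dot-notation extension.) [cite: Pratt2024SCC, Problem 1.1] -/
theorem _root_.Literature.Computability.Complexity.SetCoverInstance.family_subset_powerset_range
    {I : SetCoverInstance} {s : ℕ} (hI : I.IsSetFamily s) :
    I.family ⊆ (Finset.range I.univSize).powerset := by
  intro Y hY
  obtain ⟨S, hS, rfl⟩ := SetCoverInstance.mem_family.1 hY
  rw [Finset.mem_powerset]
  intro e he
  rw [List.mem_toFinset] at he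
  exact Finset.mem_range.2 ((hI.2 S hS).2.2 e he)

/-- The family of a well-formed `s`-set-cover instance consists of sets of size `≤ s`
(Problem 1.1: "each `X ∈ 𝓕` has size at most `s`"). (Dot-notation extension.)
[cite: Pratt2024SCC, Problem 1.1] -/
theorem _root_.Literature.Computability.Complexity.SetCoverInstance.card_le_of_mem_family
    {I : SetCoverInstance} {s : ℕ} (hI : I.IsSetFamily s) {Y : Finset ℕ} (hY : Y ∈ I.family) :
    Y.card ≤ s := by
  obtain ⟨S, hS, rfl⟩ := SetCoverInstance.mem_family.1 hY
  exact (List.toFinset_card_le S).trans (hI.2 S hS).2.1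

/-- **The acceptance predicate of `s`-Set Cover, family form**: at most `K` listed subsets cover
`[n]` (`SetCoverInstance.HasCoverWithin`, indices of chosen sets) iff at most `K` members of the
set family have union `⊇ [n]`. (Dot-notation extension.) [cite: Pratt2024SCC, Problem 1.1] -/
theorem _root_.Literature.Computability.Complexity.SetCoverInstance.hasCoverWithin_iff_family
    (I : SetCoverInstance) :
    I.HasCoverWithin ↔ ∃ G ⊆ I.family, G.card ≤ I.K ∧ Finset.range I.univSize ⊆ G.biUnion id := by
  constructor
  · rintro ⟨T, ⟨hTlen, hTcov⟩, hTK⟩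
    refine ⟨T.image fun j => (I.subsetAt j).toFinset, ?_, Finset.card_image_le.trans hTK, ?_⟩
    · exact Finset.image_subset_iff.2 fun j hj =>
        SetCoverInstance.toFinset_subsetAt_mem_family (hTlen j hj)
    · intro e he
      obtain ⟨j, hj, hej⟩ := hTcov e (Finset.mem_range.1 he)
      exact Finset.mem_biUnion.2
        ⟨(I.subsetAt j).toFinset, Finset.mem_image_of_mem _ hj, List.mem_toFinset.2 hej⟩
  · rintro ⟨G, hG, hGK, hcov⟩
    have hidx : ∀ Y ∈ G, ∃ j, j < I.sets.length ∧ (I.subsetAt j).toFinset = Y := by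
      intro Y hY
      obtain ⟨S, hS, rfl⟩ := SetCoverInstance.mem_family.1 (hG hY)
      obtain ⟨j, hj, rfl⟩ := List.mem_iff_getElem.1 hS
      refine ⟨j, hj, ?_⟩
      unfold SetCoverInstance.subsetAt
      rw [List.getD_eq_getElem _ _ hj]
    choose! idx hidxlt hidxeq using hidx
    refine ⟨G.image idx, ⟨?_, fun e he => ?_⟩, Finset.card_image_le.trans hGK⟩
    · intro j hj
      obtain ⟨Y, hY, rfl⟩ := Finset.mem_image.1 hj
      exact hidxlt Y hY
    · obtain ⟨Y, hY, heY⟩ := Finset.mem_biUnion.1 (hcov (Finset.mem_range.2 he))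
      refine ⟨idx Y, Finset.mem_image_of_mem idx hY, ?_⟩
      rw [← List.mem_toFinset, hidxeq Y hY]
      exact heY

/-! ## Balanced Tripartitioning instances versus set families -/

namespace TripartitioningInstance

/-- Three `n`-subsets of a `3n`-set with union everything are pairwise disjoint (counting).
[folklore] -/
theorem disjoint_of_card_of_union_eq_univ {n : ℕ} {A B C : Finset (Fin (3 * n))}
    (hA : A.card = n) (hB : B.card = n) (hC : C.card = n) (h : A ∪ B ∪ C = Finset.univ) :
    Disjoint A B ∧ Disjoint A C ∧ Disjoint B C := by
  have h1 := Finset.card_union_add_card_inter A B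
  have h2 := Finset.card_union_add_card_inter (A ∪ B) C
  have h3 : (A ∪ B ∪ C).card = 3 * n := by rw [h, Finset.card_univ, Fintype.card_fin]
  have h4 : (A ∪ B).card ≤ A.card + B.card := Finset.card_union_le A B
  have hAB : (A ∩ B).card = 0 := by omega
  have hABC : ((A ∪ B) ∩ C).card = 0 := by omega
  rw [Finset.card_eq_zero] at hAB hABC
  rw [Finset.union_inter_distrib_right, Finset.union_eq_empty] at hABC
  exact ⟨Finset.disjoint_iff_inter_eq_empty.2 hAB, Finset.disjoint_iff_inter_eq_empty.2 hABC.1,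
    Finset.disjoint_iff_inter_eq_empty.2 hABC.2⟩

/-- **Transport of `HasTripartition` along a relabelling.** If the three families of an instance
`I` (universe `Fin (3n)`) are, along an injection `e : Fin (3n) ↪ β`, exactly three families
`Fam i` of subsets of the range `V = e(Fin (3n))`, then `I` has a tripartition iff some members
`Y_i ∈ Fam i` are pairwise disjoint with union `V` (the form produced by Pratt's reduction, with
`V = [n] ∖ S`). [cite: Pratt2024SCC, Problem 1.3] -/
theorem hasTripartition_iff_of_map {β : Type*} [DecidableEq β] (I : TripartitioningInstance)
    (e : Fin (3 * I.n) ↪ β) (Fam : Fin 3 → Finset (Finset β))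
    (hF : ∀ i X, X ∈ I.F i ↔ X.map e ∈ Fam i) (hFam : ∀ i, ∀ Y ∈ Fam i, Y ⊆ Finset.univ.map e) :
    I.HasTripartition ↔ ∃ Y : Fin 3 → Finset β, (∀ i, Y i ∈ Fam i) ∧
      (∀ i j, i ≠ j → Disjoint (Y i) (Y j)) ∧ Finset.univ.biUnion Y = Finset.univ.map e := by
  have huniv : (Finset.univ : Finset (Fin 3)) = {0, 1, 2} := by decide
  constructor
  · rintro ⟨S, hS, T, hT, U, hU, hSTU⟩
    obtain ⟨hST', hSU', hTU'⟩ := disjoint_of_card_of_union_eq_univ (I.card_eq 0 S hS)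
      (I.card_eq 1 T hT) (I.card_eq 2 U hU) hSTU
    refine ⟨![S.map e, T.map e, U.map e], ?_, ?_, ?_⟩
    · intro i
      fin_cases i
      · exact (hF 0 S).1 hS
      · exact (hF 1 T).1 hT
      · exact (hF 2 U).1 hU
    · intro i j hij
      fin_cases i <;> fin_cases j <;>
        first
        | exact absurd rfl hij
        | simp only [Matrix.cons_val_zero, Matrix.cons_val_one, Matrix.cons_val_two,
            Matrix.head_cons, Matrix.tail_cons, Fin.mk_one, Fin.isValue, Fin.zero_eta,
            Fin.reduceFinMk, Finset.disjoint_map]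
      all_goals first
        | exact hST' | exact hSU' | exact hTU' | exact hST'.symm | exact hSU'.symm
        | exact hTU'.symm
    · rw [huniv]
      simp only [Finset.biUnion_insert, Finset.singleton_biUnion, Matrix.cons_val_zero,
        Matrix.cons_val_one, Matrix.cons_val_two, Matrix.head_cons, Matrix.tail_cons]
      rw [← Finset.map_union, ← Finset.map_union, ← Finset.union_assoc, hSTU]
  · rintro ⟨Y, hY, hYdisj, hYU⟩
    -- pull the three sets back along `e`
    have hpre : ∀ i, ∃ X : Finset (Fin (3 * I.n)), X.map e = Y i := by
      intro i
      refine ⟨Finset.univ.filter fun x => e x ∈ Y i, ?_⟩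
      ext y
      simp only [Finset.mem_map, Finset.mem_filter, Finset.mem_univ, true_and]
      constructor
      · rintro ⟨x, hx, rfl⟩
        exact hx
      · intro hy
        have hy' : y ∈ Finset.univ.map e := hFam i (Y i) (hY i) hy
        obtain ⟨x, -, rfl⟩ := Finset.mem_map.1 hy'
        exact ⟨x, hy, rfl⟩
    choose X hX using hpre
    refine ⟨X 0, (hF 0 _).2 (hX 0 ▸ hY 0), X 1, (hF 1 _).2 (hX 1 ▸ hY 1), X 2,
      (hF 2 _).2 (hX 2 ▸ hY 2), ?_⟩
    apply Finset.map_injective e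
    rw [Finset.map_union, Finset.map_union, hX, hX, hX, ← hYU, huniv, Finset.biUnion_insert,
      Finset.biUnion_insert, Finset.singleton_biUnion, Finset.union_assoc]

end TripartitioningInstance

end Literature.Computability.FineGrained
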